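import Mathlib.Analysis.Normed.Lp.lpSpace
import Literature.Analysis.Complex.LocallyUniformLimitSCV
import Literature.MathematicalPhysics.QuantumLattice.BalabanRG
import HarnessLib

/-!
# Banach spaces of quasi-local polymer activities with Bałaban–Dimock analyticity norms

Definition request `defn-QuasilocalGaugeActivityNorm` (route `BanksZaksTestbed`, crux
`BanksZaksContinuum` / child `InfraredFixedPoint16`; also the "Bałaban-norm class" of route
`HeavyThresholdYMBridge`): the **Banach space `𝒦` of gauge-invariant quasi-local polymer
activities** `K(X, V)` — `X` a connected polymer of the unit (block) lattice, `V` the block gauge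
field, `K(X, ·)` analytic in a complex strip around the group — with the weighted sup norm
`‖K‖_κ = sup_X e^{κ|X|} sup_{V ∈ strip} ‖K(X, V)‖`, in which "the effective action at scale `j`
is `S_Wilson(g_j) + Σ_X K_j(X)` with `‖K_j‖ ≤ ε_j`", "the RG map `(V, K) ↦ (V', K')` is a
contraction near a non-Gaussian fixed point `(g*, K*)`" and "`‖W_k‖ ≤ η` uniformly in `k`" are
statements about elements of / maps between genuine normed spaces.

## Content

* **Generic layer** (`PolymerActivityNorm`). Norm data `𝔫 = (κ, size, dom)` on an index type `P`
  of polymers with configuration spaces `C X` (`X : P`): decay rate `κ`, a size `|X|`, and the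
  *analyticity domains* ("strips") `dom X ⊆ C X`, open. Raw activities are
  `K : (X : P) → C X → F` (`PolymerActivity C F`, a bare type synonym; values in a complex normed
  space `F` — `F = ℂ`, or a Grassmann algebra in block fermion fields with an `h`-weighted norm
  for activities `K(X, V, ψ_B)`). `𝔫.weight X = e^{κ |X|}`; `𝔫.NormLE K η :↔ ∀ X, ∀ Z ∈ dom X,
  e^{κ|X|} ‖K X Z‖ ≤ η` ("`‖K‖_𝔫 ≤ η`", usable on raw families); `𝔫.space F`, the submodule of
  activities supported in the domains (`K X Z = 0` off `dom X`: an activity is a function ON its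
  strip, recorded as a total function extended by zero) with finite weighted sup norm. It is a
  `NormedAddCommGroup` / `NormedSpace ℂ` with `‖K‖ = sup_{X, Z} e^{κ|X|} ‖K X Z‖`
  (`norm_eq_iSup`, `weight_mul_norm_apply_le`, `norm_le_iff`) and **complete**
  (`instCompleteSpace`: isometric to a closed subspace of `ℓ^∞`). Evaluation `K ↦ K X Z` is a
  continuous linear map (`eval`). Closed submodules: `𝔫.invariant syms` (invariance of `K X` under
  a set of self-maps of `C X` on the domain — gauge transformations) and `𝔫.analytic`
  (`K X` holomorphic on `dom X`; closed by Weierstrass' theorem in several variables, tree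
  `SCV.differentiableOn_of_tendstoLocallyUniformlyOn`, for `C X` finite-dimensional and `F`
  complete); their intersection `𝔫.quasilocal syms` is again a Banach space
  (`instCompleteSpaceQuasilocal`; constructor `quasilocalMk` with `norm_quasilocalMk_le`). This
  is Dimock's space `𝒦_k` (Rev. Math. Phys. 25 (2013) §3.3,
  Def. 3: "(a) `E(X, φ)` depends on `φ` in `X`; (b) analytic and bounded in `φ ∈ ℛ_k`; …" with
  `‖E‖_{k,κ} = sup_X ‖E(X)‖_∞ e^{κ d_M(X)}`, "with any of these norms the space `𝒦_k` is
  complete"), written for a general symmetry in place of evenness.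
* **Gauge layer on the unit lattice `ℤ^d`** (`QuasilocalGaugeActivityNorm d ρ`, the notion).
  Polymers are `ConnectedPolymer d`: nonempty finite unions of unit blocks (labelled by sites of
  `ℤ^d`, tree `Site d`) connected through shared faces (tree `zdGraph d`; Dimock §3.1). The block
  gauge field restricted to `X` lives in `PolymerGaugeConfig N X = (X × Fin d → M_N(ℂ))`: an
  `N × N` complex matrix on every positively oriented bond based in `X` (locality, Bałaban's
  property (i) "it depends on `U_k` restricted to `X`", CMP 119 (1988) p. 259, is thus built into
  the type; `polymerRestrict ρ X U` restricts a real configuration `U : LGConfig d G` through the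
  representation `ρ`). The **strip** `smallFieldStrip ρ r ε X` is the open `r`-neighbourhood
  (sup over bonds of Frobenius distances) of the restrictions of the real configurations whose
  plaquettes based in `X` are `ε`-small (tree `smallFieldRegion`) — the one-scale rendering of
  Bałaban's analyticity spaces `U_j(X, α₀, α₁)` of complex configurations `U'Ũ`, `Ũ` a real small
  field, `U' = exp(iξA')` small (CMP 119 p. 261 (2.34)–(2.39)); for `ε ≥ 2N` (unitary `ρ`) it is
  the plain strip of width `r` around `ρ(G)^{bonds}`. Gauge transformations `u : ℤ^d → G` act on
  `PolymerGaugeConfig N X` by `polymerGaugeAct ρ X u` (`polymerRestrict_gaugeTransformZd`). The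
  norm data `𝔫 = ⟨κ, r, ε⟩ : QuasilocalGaugeActivityNorm d ρ` give `𝔫.toPolymerActivityNorm`
  (size `|X|` = number of blocks) and **the Banach space `𝔫.Space F`** of activities that are
  gauge invariant on the strips (Bałaban's (iii) "the extended function is invariant with respect
  to the gauge transformations") and analytic there ((ii)), normed by
  `‖K‖ = sup_X e^{κ|X|} sup_{Z ∈ strip X} ‖K X Z‖` (the sup form of (iv)/(2.42)
  `|E(X)| ≤ E₀ e^{-κ d_j(X)}`): `mem_Space_iff`, `norm_le_iff`, `instCompleteSpaceSpace`,
  evaluation on real fields `onField` with its gauge invariance `onField_gaugeTransformZd`, and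
  non-vacuity `exists_ne_zero`.

## Design choices and faithfulness flags

* Size `|X|` = number of unit blocks, in place of Bałaban's `d_j(X)` / Dimock's `d_M(X)` (length
  of the shortest tree joining the blocks of `X`); Dimock §3.3: `d_M(X) ≤ |X|_M ≤ 3^d (1 + d_M(X))`,
  so `e^{κ|X|}` dominates `e^{κ d_M(X)}` and the two families of norms define the same notion of
  exponential quasi-locality up to the value of `κ`. The generic layer takes any `size`.
* Activities are indexed by CONNECTED polymers (Dimock's `𝒟_k`; Brydges–Slade take sups over
  connected polymers); the same construction with `P = Finset (Site d)` gives the unrestricted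
  variant. Infinite volume (`ℤ^d`, the unit lattice after rescaling) is what a fixed-point
  statement needs; finite tori are further instances of the generic layer (cf. the sibling
  `QuantumFieldTheory.QuasiLocalGaugePerturbation`, the torus class with the Kotecký–Preiss
  `ℓ¹`-in-`X` norm `sup_B Σ_{X ∋ B} ‖W_X‖ e^{κ|X|}`; here the norm is `ℓ^∞` in `X`, as printed by
  Bałaban (2.42) and Dimock, and `Σ_{X ∋ □} e^{-κ₀ d_M(X)} ≤ K₀` converts between them).
* An activity is a function on its strip: it is stored as a total function on `C X` vanishing
  off `dom X` (`IsSupported`), so that the sup over the strip is a norm and evaluation is total;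
  invariance is required between points of the strip only (the strips are gauge invariant for
  unitary `ρ`; not needed here).
* Deliberately NOT here: the Brydges–Slade `T_φ(h)`-seminorm / regulator format of
  Bauerschmidt–Brydges–Slade (LNM 2242, Ch. 7 and App. A §A.6: `‖K(X)‖_w = sup_φ ‖K(X)‖_{T_φ} /
  w(X, φ)`, "a complete Banach space after an additional weighted supremum over polymers"), the
  Grassmann algebra carrying the `h`-weights (enter through `F`), translation covariance and
  reflection conditions (further closed submodules via `eval`), and any RG map.

## Mathlib status

Mathlib has `lp`/`ℓ^∞` (used: the space is normed by pulling back along the weighted embedding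
`K ↦ ((X, Z) ↦ e^{κ|X|} K X Z)` into `lp (fun _ : Σ X, C X => F) ∞`, `NormedAddCommGroup.induced`,
`completeSpace_iff_isComplete_range`), no polymer-activity spaces. Matrices carry the Frobenius
norm (`open scoped Matrix.Norms.Frobenius`, as in the sibling torus file).

## References

* T. Bałaban, *Convergent renormalization expansions for lattice gauge theories*, CMP 119 (1988)
  243–285: p. 259 (2.27) and properties (i)–(iv); p. 261 (2.34)–(2.42). [Balaban1988Convergent]
* J. Dimock, *The renormalization group according to Bałaban. I. Small fields*, Rev. Math. Phys.
  25 (2013) 1330010, §3.1 (polymers), §3.3 (Def. 3, the norm `‖E‖_{k,κ}`, completeness). [Dimock2013]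
* R. Bauerschmidt, D. C. Brydges, G. Slade, *Introduction to a Renormalisation Group Method*, LNM
  2242 (2019), Ch. 7 (`T_φ`-seminorm), App. A §A.6 (norms, weighted sup over polymers). [BauerschmidtBrydgesSlade2019RG]
* L. Hörmander, *An Introduction to Complex Analysis in Several Variables*, Cor. 2.2.5
  (Weierstrass' theorem; tree `LocallyUniformLimitSCV`). [HormanderSCV1973]
-/

noncomputable section

open scoped ENNReal Topology Matrix.Norms.Frobenius
open Filter Set
open Literature.Probability.LatticeModels

namespace Literature.MathematicalPhysics.QuantumLattice

universe u v w

/-! ### Norm data, raw activities, and the weighted sup-norm Banach space -/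

/-- **Norm data for quasi-local polymer activities**: a decay rate `κ`, a size function `|X|` on
the polymers `X : P`, and for every polymer an (open) analyticity domain `dom X ⊆ C X` of
configurations — Dimock's `(κ, d_M, ℛ_k)` (Rev. Math. Phys. 25 (2013) §3.3) / Bałaban's
`(κ, d_j, U_j(X, α₀, α₁))` (CMP 119 (1988) p. 261). The norm it defines is
`‖K‖_𝔫 = sup_X e^{κ|X|} sup_{Z ∈ dom X} ‖K X Z‖`. [cite: Dimock2013, §3.3 Def. 3] -/
structure PolymerActivityNorm (P : Type u) (C : P → Type v) [∀ X, TopologicalSpace (C X)] where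
  /-- The exponential decay rate `κ`. -/
  κ : ℝ
  /-- The size `|X|` of a polymer (number of blocks, or a tree length `d_M(X)`). -/
  size : P → ℝ
  /-- The analyticity domain ("strip") of the activity of `X`. -/
  dom : (X : P) → Set (C X)
  /-- The domains are open (so that differentiability on them is holomorphy). -/
  isOpen_dom : ∀ X, IsOpen (dom X)

/-- **Raw polymer activities** `K(X, Z)`, `X : P` a polymer, `Z : C X` a configuration on `X`,
values in `F`: a bare type synonym for `(X : P) → C X → F` carrying only the vector-space
structure (no product topology, which would conflict with the norm topology put on the
subspaces below — the device of Mathlib's `PreLp`). [folklore] -/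
def PolymerActivity {P : Type u} (C : P → Type v) (F : Type w) : Type (max u v w) :=
  (X : P) → C X → F

namespace PolymerActivity

variable {P : Type u} {C : P → Type v} {F : Type w} [AddCommGroup F]

/-- Pointwise additive group structure on raw activities. [folklore] -/
instance instAddCommGroup : AddCommGroup (PolymerActivity C F) :=
  inferInstanceAs (AddCommGroup ((X : P) → C X → F))

/-- Pointwise complex vector-space structure on raw activities. [folklore] -/
instance instModule [Module ℂ F] : Module ℂ (PolymerActivity C F) :=
  inferInstanceAs (Module ℂ ((X : P) → C X → F))

/-- Addition of activities is pointwise. [folklore] -/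
@[simp] theorem add_apply (K K' : PolymerActivity C F) (X : P) (Z : C X) :
    (K + K') X Z = K X Z + K' X Z := rfl

/-- Subtraction of activities is pointwise. [folklore] -/
@[simp] theorem sub_apply (K K' : PolymerActivity C F) (X : P) (Z : C X) :
    (K - K') X Z = K X Z - K' X Z := rfl

/-- Negation of activities is pointwise. [folklore] -/
@[simp] theorem neg_apply (K : PolymerActivity C F) (X : P) (Z : C X) : (-K) X Z = -K X Z := rfl

/-- The zero activity vanishes. [folklore] -/
@[simp] theorem zero_apply (X : P) (Z : C X) : (0 : PolymerActivity C F) X Z = 0 := rfl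

/-- Scalar multiplication of activities is pointwise. [folklore] -/
@[simp] theorem smul_apply [Module ℂ F] (c : ℂ) (K : PolymerActivity C F) (X : P) (Z : C X) :
    (c • K) X Z = c • K X Z := rfl

end PolymerActivity

namespace PolymerActivityNorm

variable {P : Type u} {C : P → Type v} [∀ X, NormedAddCommGroup (C X)]
variable (𝔫 : PolymerActivityNorm P C) (F : Type w) [NormedAddCommGroup F]

/-- The weight `e^{κ |X|}` of the polymer `X`. [cite: Dimock2013, §3.3 Def. 3] -/
def weight (X : P) : ℝ := Real.exp (𝔫.κ * 𝔫.size X)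

/-- Weights are positive. [folklore] -/
theorem weight_pos (X : P) : 0 < 𝔫.weight X := Real.exp_pos _

variable {F} in
/-- **`‖K‖_𝔫 ≤ η`** for a raw activity: `e^{κ|X|} ‖K X Z‖ ≤ η` for every polymer `X` and every
configuration `Z` in the strip `dom X` — i.e. `sup_X e^{κ|X|} sup_{Z ∈ dom X} ‖K X Z‖ ≤ η`, the
sup form of Bałaban's bound `|E(X)| ≤ E₀ e^{-κ d(X)}` (CMP 119 (1988) (2.42)). Usable on raw
families (`W_k` with `‖W_k‖ ≤ η` uniformly in `k`) before membership in the space is known;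
for members it is `‖K‖ ≤ η` (`norm_le_iff`). [cite: Balaban1988Convergent, p. 261 (2.42)] -/
def NormLE (K : PolymerActivity C F) (η : ℝ) : Prop :=
  ∀ X, ∀ Z ∈ 𝔫.dom X, 𝔫.weight X * ‖K X Z‖ ≤ η

variable {F} in
/-- An activity is **supported in the domains**: `K X Z = 0` for `Z ∉ dom X` (an activity is a
function on its strip, stored as a total function extended by zero). [folklore] -/
def IsSupported (K : PolymerActivity C F) : Prop :=
  ∀ X Z, Z ∉ 𝔫.dom X → K X Z = 0

variable {𝔫 F} in
/-- Norm bounds are monotone in the bound. [folklore] -/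
theorem NormLE.mono {K : PolymerActivity C F} {η η' : ℝ} (h : 𝔫.NormLE K η) (hη : η ≤ η') :
    𝔫.NormLE K η' :=
  fun X Z hZ => (h X Z hZ).trans hη

variable [NormedSpace ℂ F]

/-- **The weighted sup-norm space** of `𝔫`: activities supported in the domains with finite norm
`sup_X e^{κ|X|} sup_{Z ∈ dom X} ‖K X Z‖ < ∞`, a complex vector space (a `Submodule`; its norm and
completeness follow). Dimock's `𝒦_k` before the symmetry/analyticity conditions. [cite: Dimock2013, §3.3 Def. 3] -/
def space : Submodule ℂ (PolymerActivity C F) where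
  carrier := {K | 𝔫.IsSupported K ∧ ∃ η, 𝔫.NormLE K η}
  zero_mem' := ⟨fun _ _ _ => rfl, 0, fun X Z _ => by simp⟩
  add_mem' := by
    rintro K K' ⟨hK, η, hη⟩ ⟨hK', η', hη'⟩
    refine ⟨fun X Z hZ => by simp [hK X Z hZ, hK' X Z hZ], η + η', fun X Z hZ => ?_⟩
    calc 𝔫.weight X * ‖(K + K') X Z‖ ≤ 𝔫.weight X * (‖K X Z‖ + ‖K' X Z‖) :=
          mul_le_mul_of_nonneg_left (by rw [PolymerActivity.add_apply]; exact norm_add_le _ _)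
            (𝔫.weight_pos X).le
      _ ≤ η + η' := by rw [mul_add]; exact add_le_add (hη X Z hZ) (hη' X Z hZ)
  smul_mem' := by
    rintro c K ⟨hK, η, hη⟩
    refine ⟨fun X Z hZ => by simp [hK X Z hZ], ‖c‖ * η, fun X Z hZ => ?_⟩
    calc 𝔫.weight X * ‖(c • K) X Z‖ = ‖c‖ * (𝔫.weight X * ‖K X Z‖) := by
          rw [PolymerActivity.smul_apply, norm_smul]; ring
      _ ≤ ‖c‖ * η := mul_le_mul_of_nonneg_left (hη X Z hZ) (norm_nonneg c)

variable {𝔫 F}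

/-- Elements of the space are functions `K X Z`. [folklore] -/
instance instCoeFun : CoeFun (𝔫.space F) fun _ => (X : P) → C X → F := ⟨fun K => K.1⟩

/-- Membership in the space: supported in the domains, finite weighted sup norm. [folklore] -/
theorem mem_space_iff {K : PolymerActivity C F} :
    K ∈ 𝔫.space F ↔ 𝔫.IsSupported K ∧ ∃ η, 𝔫.NormLE K η := Iff.rfl

/-- Two elements with the same values are equal. [folklore] -/
@[ext] theorem ext {K K' : 𝔫.space F} (h : ∀ X Z, K X Z = K' X Z) : K = K' :=
  Subtype.ext (funext fun X => funext fun Z => h X Z)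

/-- Addition in the space is pointwise. [folklore] -/
@[simp] theorem add_apply (K K' : 𝔫.space F) (X : P) (Z : C X) : (K + K') X Z = K X Z + K' X Z := rfl

/-- Subtraction in the space is pointwise. [folklore] -/
@[simp] theorem sub_apply (K K' : 𝔫.space F) (X : P) (Z : C X) : (K - K') X Z = K X Z - K' X Z := rfl

/-- Negation in the space is pointwise. [folklore] -/
@[simp] theorem neg_apply (K : 𝔫.space F) (X : P) (Z : C X) : (-K) X Z = -K X Z := rfl

/-- The zero element vanishes. [folklore] -/
@[simp] theorem zero_apply (X : P) (Z : C X) : (0 : 𝔫.space F) X Z = 0 := rfl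

/-- Scalar multiplication in the space is pointwise. [folklore] -/
@[simp] theorem smul_apply (c : ℂ) (K : 𝔫.space F) (X : P) (Z : C X) : (c • K) X Z = c • K X Z := rfl

/-- Elements vanish off the domains. [folklore] -/
theorem apply_eq_zero_of_not_mem (K : 𝔫.space F) {X : P} {Z : C X} (hZ : Z ∉ 𝔫.dom X) :
    K X Z = 0 :=
  K.2.1 X Z hZ

variable (𝔫 F)

/-- **The weighted embedding into `ℓ^∞`**: `K ↦ ((X, Z) ↦ e^{κ|X|} K X Z)`, a linear map into
`lp (fun _ : Σ X, C X => F) ∞`; the norm of the space is pulled back along it. [folklore] -/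
def toLp : 𝔫.space F →ₗ[ℂ] lp (fun _ : (Σ X, C X) => F) ∞ where
  toFun K := ⟨fun p => (𝔫.weight p.1 : ℂ) • K p.1 p.2, by
    obtain ⟨η, hη⟩ := K.2.2
    refine memℓp_infty ⟨max η 0, ?_⟩
    rintro _ ⟨p, rfl⟩
    dsimp only
    rw [norm_smul, Complex.norm_real, Real.norm_of_nonneg (𝔫.weight_pos p.1).le]
    by_cases hp : p.2 ∈ 𝔫.dom p.1
    · exact (hη p.1 p.2 hp).trans (le_max_left _ _)
    · rw [K.2.1 p.1 p.2 hp, norm_zero, mul_zero]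
      exact le_max_right _ _⟩
  map_add' K K' := by ext p; simp [smul_add]
  map_smul' c K := by ext p; simp [smul_comm (𝔫.weight _ : ℂ) c]

variable {𝔫 F} in
/-- Values of the weighted embedding. [folklore] -/
@[simp] theorem toLp_apply (K : 𝔫.space F) (p : Σ X, C X) :
    𝔫.toLp F K p = (𝔫.weight p.1 : ℂ) • K p.1 p.2 := rfl

variable {𝔫 F} in
/-- Norms of the values of the weighted embedding: `‖e^{κ|X|} K X Z‖ = e^{κ|X|} ‖K X Z‖`. [folklore] -/
theorem norm_toLp_apply (K : 𝔫.space F) (p : Σ X, C X) :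
    ‖𝔫.toLp F K p‖ = 𝔫.weight p.1 * ‖K p.1 p.2‖ := by
  rw [toLp_apply, norm_smul, Complex.norm_real, Real.norm_of_nonneg (𝔫.weight_pos p.1).le]

/-- The weighted embedding is injective (weights are non-zero). [folklore] -/
theorem toLp_injective : Function.Injective (𝔫.toLp F) := by
  intro K K' h
  ext X Z
  have h' := congr_arg (fun f : lp (fun _ : (Σ X, C X) => F) ∞ => f ⟨X, Z⟩) h
  simp only [toLp_apply] at h'
  exact smul_right_injective F (by exact_mod_cast (𝔫.weight_pos X).ne') h'

/-- **The norm** `‖K‖ = sup_{X, Z} e^{κ|X|} ‖K X Z‖` on the space, pulled back from `ℓ^∞` along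
the weighted embedding (Dimock's `‖E‖_{k,κ} = sup_X ‖E(X)‖_∞ e^{κ d_M(X)}`). [cite: Dimock2013, §3.3 Def. 3] -/
instance instNormedAddCommGroup : NormedAddCommGroup (𝔫.space F) :=
  NormedAddCommGroup.induced (𝔫.space F) (lp (fun _ : (Σ X, C X) => F) ∞) (𝔫.toLp F)
    (𝔫.toLp_injective F)

variable {𝔫 F} in
/-- The norm is the `ℓ^∞` norm of the weighted embedding (by construction). [folklore] -/
theorem norm_def (K : 𝔫.space F) : ‖K‖ = ‖𝔫.toLp F K‖ := rfl

/-- The space is a complex normed space. [folklore] -/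
instance instNormedSpace : NormedSpace ℂ (𝔫.space F) where
  norm_smul_le c K := by rw [norm_def, norm_def, map_smul]; exact norm_smul_le c _

variable {𝔫 F}

/-- **The norm is the weighted sup norm**: `‖K‖ = sup_{(X, Z)} e^{κ|X|} ‖K X Z‖` (the sup may be
restricted to `Z ∈ dom X`, off which `K X Z = 0`). [cite: Dimock2013, §3.3 Def. 3] -/
theorem norm_eq_iSup (K : 𝔫.space F) : ‖K‖ = ⨆ p : Σ X, C X, 𝔫.weight p.1 * ‖K p.1 p.2‖ := by
  rw [norm_def, lp.norm_eq_ciSup]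
  exact iSup_congr fun p => norm_toLp_apply K p

/-- `e^{κ|X|} ‖K X Z‖ ≤ ‖K‖`. [folklore] -/
theorem weight_mul_norm_apply_le (K : 𝔫.space F) (X : P) (Z : C X) :
    𝔫.weight X * ‖K X Z‖ ≤ ‖K‖ := by
  rw [← norm_toLp_apply K ⟨X, Z⟩, norm_def]
  exact lp.norm_apply_le_norm ENNReal.top_ne_zero _ _

/-- `‖K X Z‖ ≤ e^{-κ|X|} ‖K‖`: Bałaban's pointwise format (iv). [cite: Balaban1988Convergent, p. 261 (2.42)] -/
theorem norm_apply_le (K : 𝔫.space F) (X : P) (Z : C X) : ‖K X Z‖ ≤ (𝔫.weight X)⁻¹ * ‖K‖ := by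
  rw [le_inv_mul_iff₀ (𝔫.weight_pos X)]
  exact weight_mul_norm_apply_le K X Z

/-- A member satisfies its own norm bound: `NormLE K ‖K‖`. [folklore] -/
theorem normLE_norm (K : 𝔫.space F) : 𝔫.NormLE (K : PolymerActivity C F) ‖K‖ :=
  fun X Z _ => weight_mul_norm_apply_le K X Z

/-- A norm bound `NormLE K η` (over the strips) bounds the norm. [folklore] -/
theorem norm_le_of_normLE {K : 𝔫.space F} {η : ℝ} (hη : 0 ≤ η)
    (h : 𝔫.NormLE (K : PolymerActivity C F) η) : ‖K‖ ≤ η := by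
  rw [norm_def]
  refine lp.norm_le_of_forall_le hη fun p => ?_
  rw [norm_toLp_apply]
  by_cases hp : p.2 ∈ 𝔫.dom p.1
  · exact h p.1 p.2 hp
  · rw [apply_eq_zero_of_not_mem K hp, norm_zero, mul_zero]
    exact hη

/-- **`‖K‖ ≤ η ↔ ‖K‖_𝔫 ≤ η`**: the norm of the space is the printed weighted sup over the strips. [cite: Dimock2013, §3.3 Def. 3] -/
theorem norm_le_iff {K : 𝔫.space F} {η : ℝ} (hη : 0 ≤ η) :
    ‖K‖ ≤ η ↔ 𝔫.NormLE (K : PolymerActivity C F) η :=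
  ⟨fun h => (normLE_norm K).mono h, norm_le_of_normLE hη⟩

variable (𝔫 F)

/-- The weighted embedding is an isometry (by construction of the norm). [folklore] -/
theorem isometry_toLp : Isometry (𝔫.toLp F) := fun _ _ => rfl

/-- The range of the weighted embedding: exactly the `ℓ^∞` functions vanishing off the domains. [folklore] -/
theorem range_toLp :
    Set.range (𝔫.toLp F) = {f | ∀ X (Z : C X), Z ∉ 𝔫.dom X → f ⟨X, Z⟩ = 0} := by
  ext f
  constructor
  · rintro ⟨K, rfl⟩ X Z hZ
    simp [apply_eq_zero_of_not_mem K hZ]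
  · intro hf
    have hb : ∀ X (Z : C X), 𝔫.weight X * ‖((𝔫.weight X)⁻¹ : ℂ) • f ⟨X, Z⟩‖ = ‖f ⟨X, Z⟩‖ :=
      fun X Z => by
        rw [norm_smul, norm_inv, Complex.norm_real, Real.norm_of_nonneg (𝔫.weight_pos X).le,
          ← mul_assoc, mul_inv_cancel₀ (𝔫.weight_pos X).ne', one_mul]
    refine ⟨⟨fun X Z => ((𝔫.weight X)⁻¹ : ℂ) • f ⟨X, Z⟩, fun X Z hZ => by simp [hf X Z hZ], ‖f‖,
      fun X Z _ => ?_⟩, ?_⟩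
    · rw [hb]
      exact lp.norm_apply_le_norm ENNReal.top_ne_zero f ⟨X, Z⟩
    · ext ⟨X, Z⟩
      simp only [toLp_apply]
      change (𝔫.weight X : ℂ) • ((𝔫.weight X)⁻¹ : ℂ) • f ⟨X, Z⟩ = f ⟨X, Z⟩
      rw [smul_smul, mul_inv_cancel₀ (by exact_mod_cast (𝔫.weight_pos X).ne'), one_smul]

/-- **Completeness**: the weighted sup-norm space is a Banach space (for complete `F`) — it is
isometric to the closed subspace of `ℓ^∞` of functions vanishing off the domains (Dimock: "with
any of these norms the space `𝒦_k` is complete and hence a complex Banach space"). [cite: Dimock2013, §3.3] -/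
instance instCompleteSpace [CompleteSpace F] : CompleteSpace (𝔫.space F) := by
  refine (completeSpace_iff_isComplete_range (𝔫.isometry_toLp F).isUniformInducing).2 ?_
  refine IsClosed.isComplete ?_
  rw [range_toLp]
  simp only [Set.setOf_forall]
  refine isClosed_iInter fun X => isClosed_iInter fun Z => isClosed_iInter fun _ => ?_
  exact isClosed_eq ((continuous_apply _).comp lp.uniformContinuous_coe.continuous)
    continuous_const

/-- **Evaluation** `K ↦ K X Z` is a continuous linear map of norm `≤ e^{-κ|X|}`. [folklore] -/
def eval (X : P) (Z : C X) : 𝔫.space F →L[ℂ] F :=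
  LinearMap.mkContinuous ⟨⟨fun K => K X Z, fun _ _ => rfl⟩, fun _ _ => rfl⟩ (𝔫.weight X)⁻¹
    fun K => norm_apply_le K X Z

variable {𝔫 F} in
/-- Values of the evaluation map. [folklore] -/
@[simp] theorem eval_apply (X : P) (Z : C X) (K : 𝔫.space F) : 𝔫.eval F X Z K = K X Z := rfl

/-- Evaluation at `(X, Z)` is continuous in `K`. [folklore] -/
theorem continuous_apply_apply (X : P) (Z : C X) : Continuous fun K : 𝔫.space F => K X Z :=
  (𝔫.eval F X Z).continuous

/-! ### Closed submodules: invariance and analyticity -/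

/-- **Invariant activities**: for every polymer `X` and every symmetry `γ ∈ syms X` (a self-map
of `C X` — gauge transformations restricted to `X`), `K X (γ Z) = K X Z` whenever `Z` and `γ Z`
both lie in the strip `dom X` (Bałaban's property (iii): "the extended function is invariant
with respect to the gauge transformations", CMP 119 (1988) p. 259 and p. 261). [cite: Balaban1988Convergent, p. 259 (iii)] -/
def invariant (syms : (X : P) → Set (C X → C X)) : Submodule ℂ (𝔫.space F) where
  carrier := {K | ∀ X, ∀ γ ∈ syms X, ∀ Z ∈ 𝔫.dom X, γ Z ∈ 𝔫.dom X → K X (γ Z) = K X Z}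
  zero_mem' := fun _ _ _ _ _ _ => rfl
  add_mem' := fun hK hK' X γ hγ Z hZ hγZ => by
    rw [add_apply, add_apply, hK X γ hγ Z hZ hγZ, hK' X γ hγ Z hZ hγZ]
  smul_mem' := fun c K hK X γ hγ Z hZ hγZ => by rw [smul_apply, smul_apply, hK X γ hγ Z hZ hγZ]

variable {𝔫 F} in
/-- Membership in the invariant submodule. [folklore] -/
theorem mem_invariant_iff {syms : (X : P) → Set (C X → C X)} {K : 𝔫.space F} :
    K ∈ 𝔫.invariant F syms ↔
      ∀ X, ∀ γ ∈ syms X, ∀ Z ∈ 𝔫.dom X, γ Z ∈ 𝔫.dom X → K X (γ Z) = K X Z :=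
  Iff.rfl

/-- The invariant submodule is closed (intersection of kernels of differences of evaluations). [folklore] -/
theorem isClosed_invariant (syms : (X : P) → Set (C X → C X)) :
    IsClosed ((𝔫.invariant F syms : Submodule ℂ (𝔫.space F)) : Set (𝔫.space F)) := by
  change IsClosed {K : 𝔫.space F | ∀ X, ∀ γ ∈ syms X, ∀ Z ∈ 𝔫.dom X, γ Z ∈ 𝔫.dom X →
    K X (γ Z) = K X Z}
  simp only [Set.setOf_forall]
  refine isClosed_iInter fun X => isClosed_iInter fun γ => isClosed_iInter fun _ =>
    isClosed_iInter fun Z => isClosed_iInter fun _ => isClosed_iInter fun _ => ?_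
  exact isClosed_eq (𝔫.continuous_apply_apply F X (γ Z)) (𝔫.continuous_apply_apply F X Z)

variable [∀ X, NormedSpace ℂ (C X)]

/-- **Analytic activities**: `K X` is holomorphic (`DifferentiableOn ℂ`) on the open strip
`dom X` for every polymer `X` (Bałaban's property (ii) "there exists an analytic function …
which is an extension of this term", CMP 119 (1988) p. 259; Dimock's (b) "analytic and bounded
in `φ ∈ ℛ_k`"). [cite: Balaban1988Convergent, p. 259 (ii)] -/
def analytic : Submodule ℂ (𝔫.space F) where
  carrier := {K | ∀ X, DifferentiableOn ℂ (fun Z => K X Z) (𝔫.dom X)}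
  zero_mem' := fun _ => differentiableOn_const (0 : F)
  add_mem' := fun hK hK' X => (hK X).add (hK' X)
  smul_mem' := fun c _ hK X => (hK X).const_smul c

variable {𝔫 F} in
/-- Membership in the analytic submodule. [folklore] -/
theorem mem_analytic_iff {K : 𝔫.space F} :
    K ∈ 𝔫.analytic F ↔ ∀ X, DifferentiableOn ℂ (fun Z => K X Z) (𝔫.dom X) :=
  Iff.rfl

/-- **The analytic submodule is closed** when the configuration spaces are finite-dimensional and
`F` is complete: norm convergence is uniform convergence on every strip (weights are positive),
and uniform limits of holomorphic maps on an open set are holomorphic (Weierstrass' theorem in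
several variables, tree `SCV.differentiableOn_of_tendstoLocallyUniformlyOn`). [cite: HormanderSCV1973, Cor. 2.2.5] -/
theorem isClosed_analytic [∀ X, FiniteDimensional ℂ (C X)] [CompleteSpace F] :
    IsClosed ((𝔫.analytic F : Submodule ℂ (𝔫.space F)) : Set (𝔫.space F)) := by
  refine IsSeqClosed.isClosed fun K Klim hK hlim X => ?_
  have hunif : TendstoUniformlyOn (fun n Z => K n X Z) (fun Z => Klim X Z) atTop (𝔫.dom X) := by
    rw [Metric.tendstoUniformlyOn_iff]
    intro ε hε
    have h0 : Tendsto (fun n => ‖K n - Klim‖) atTop (𝓝 0) :=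
      tendsto_iff_norm_sub_tendsto_zero.1 hlim
    filter_upwards [h0.eventually (gt_mem_nhds (mul_pos hε (𝔫.weight_pos X)))] with n hn Z _
    rw [dist_comm, dist_eq_norm]
    calc ‖K n X Z - Klim X Z‖ = ‖(K n - Klim) X Z‖ := by rw [sub_apply]
      _ ≤ (𝔫.weight X)⁻¹ * ‖K n - Klim‖ := norm_apply_le _ X Z
      _ < (𝔫.weight X)⁻¹ * (ε * 𝔫.weight X) :=
          mul_lt_mul_of_pos_left hn (inv_pos.2 (𝔫.weight_pos X))
      _ = ε := by
          rw [mul_comm ε, ← mul_assoc, inv_mul_cancel₀ (𝔫.weight_pos X).ne', one_mul]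
  exact Literature.Analysis.Complex.SCV.differentiableOn_of_tendstoLocallyUniformlyOn
    (𝔫.isOpen_dom X) (fun n => hK n X) hunif.tendstoLocallyUniformlyOn

/-- **The space `𝒦_𝔫(syms)` of invariant analytic quasi-local activities**: the intersection of
the invariant and the analytic submodules of the weighted sup-norm space — Dimock's `𝒦_k`
(Def. 3) with gauge invariance in place of evenness, Bałaban's class (i)–(iv). [cite: Dimock2013, §3.3 Def. 3] -/
def quasilocal (syms : (X : P) → Set (C X → C X)) : Submodule ℂ (𝔫.space F) :=
  𝔫.invariant F syms ⊓ 𝔫.analytic F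

variable {𝔫 F} in
/-- Membership in `𝒦_𝔫(syms)`: invariance on the strips and analyticity on the strips. [folklore] -/
theorem mem_quasilocal_iff {syms : (X : P) → Set (C X → C X)} {K : 𝔫.space F} :
    K ∈ 𝔫.quasilocal F syms ↔
      (∀ X, ∀ γ ∈ syms X, ∀ Z ∈ 𝔫.dom X, γ Z ∈ 𝔫.dom X → K X (γ Z) = K X Z) ∧
        ∀ X, DifferentiableOn ℂ (fun Z => K X Z) (𝔫.dom X) :=
  Submodule.mem_inf

/-- `𝒦_𝔫(syms)` is closed in the weighted sup-norm space. [folklore] -/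
theorem isClosed_quasilocal [∀ X, FiniteDimensional ℂ (C X)] [CompleteSpace F]
    (syms : (X : P) → Set (C X → C X)) :
    IsClosed ((𝔫.quasilocal F syms : Submodule ℂ (𝔫.space F)) : Set (𝔫.space F)) := by
  rw [quasilocal, Submodule.coe_inf]
  exact (𝔫.isClosed_invariant F syms).inter (𝔫.isClosed_analytic F)

/-- **`𝒦_𝔫(syms)` is a Banach space** (closed subspace of a Banach space). [cite: Dimock2013, §3.3] -/
instance instCompleteSpaceQuasilocal [∀ X, FiniteDimensional ℂ (C X)] [CompleteSpace F]
    (syms : (X : P) → Set (C X → C X)) : CompleteSpace (𝔫.quasilocal F syms) :=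
  (𝔫.isClosed_quasilocal F syms).isComplete.completeSpace_coe

variable {𝔫 F} in
/-- **Constructor**: a raw activity that is supported in the strips, has `‖K‖_𝔫 ≤ η`, is
invariant on the strips and holomorphic there is an element of `𝒦_𝔫(syms)`. [folklore] -/
def quasilocalMk {syms : (X : P) → Set (C X → C X)} (K : PolymerActivity C F)
    (hs : 𝔫.IsSupported K) {η : ℝ} (hη : 𝔫.NormLE K η)
    (hinv : ∀ X, ∀ γ ∈ syms X, ∀ Z ∈ 𝔫.dom X, γ Z ∈ 𝔫.dom X → K X (γ Z) = K X Z)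
    (han : ∀ X, DifferentiableOn ℂ (K X) (𝔫.dom X)) : 𝔫.quasilocal F syms :=
  ⟨⟨K, hs, η, hη⟩, hinv, han⟩

variable {𝔫 F} in
/-- Values of the constructed element. [folklore] -/
@[simp] theorem quasilocalMk_apply {syms : (X : P) → Set (C X → C X)} (K : PolymerActivity C F)
    (hs : 𝔫.IsSupported K) {η : ℝ} (hη : 𝔫.NormLE K η)
    (hinv : ∀ X, ∀ γ ∈ syms X, ∀ Z ∈ 𝔫.dom X, γ Z ∈ 𝔫.dom X → K X (γ Z) = K X Z)
    (han : ∀ X, DifferentiableOn ℂ (K X) (𝔫.dom X)) (X : P) (Z : C X) :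
    (quasilocalMk K hs hη hinv han : 𝔫.space F) X Z = K X Z := rfl

variable {𝔫 F} in
/-- The norm of the constructed element is at most the given bound `η ≥ 0`. [folklore] -/
theorem norm_quasilocalMk_le {syms : (X : P) → Set (C X → C X)} (K : PolymerActivity C F)
    (hs : 𝔫.IsSupported K) {η : ℝ} (hη0 : 0 ≤ η) (hη : 𝔫.NormLE K η)
    (hinv : ∀ X, ∀ γ ∈ syms X, ∀ Z ∈ 𝔫.dom X, γ Z ∈ 𝔫.dom X → K X (γ Z) = K X Z)
    (han : ∀ X, DifferentiableOn ℂ (K X) (𝔫.dom X)) :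
    ‖quasilocalMk K hs hη hinv han‖ ≤ η :=
  norm_le_of_normLE (K := (quasilocalMk K hs hη hinv han : 𝔫.space F)) hη0 hη

end PolymerActivityNorm

/-! ### The unit lattice `ℤ^d`: connected polymers, polymer gauge fields, strips -/

section Gauge

variable {d N : ℕ} {G : Type*} [Group G]

/-- **Connected polymers of the unit lattice**: nonempty finite unions `X` of unit blocks
(labelled by the sites of `ℤ^d`) that are connected through shared faces, i.e. the
nearest-neighbour graph `zdGraph d` induced on `X` is connected (Dimock, Rev. Math. Phys. 25
(2013) §3.1: "an `M`-polymer `X` is a connected union of such cubes … `□_j` and `□_{j+1}` have a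
`d-1` dimensional face in common"; here on the unit lattice, `M = 1`). [cite: Dimock2013, §3.1] -/
abbrev ConnectedPolymer (d : ℕ) : Type :=
  {X : Finset (Site d) // ((zdGraph d).induce (X : Set (Site d))).Connected}

/-- A single block is a connected polymer. [folklore] -/
def ConnectedPolymer.single (x : Site d) : ConnectedPolymer d :=
  ⟨{x}, by
    haveI : Nonempty (↥((({x} : Finset (Site d)) : Set (Site d)))) := ⟨⟨x, by simp⟩⟩
    refine SimpleGraph.Connected.mk fun a b => ?_
    obtain ⟨a, ha⟩ := a
    obtain ⟨b, hb⟩ := b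
    simp only [Finset.coe_singleton, Set.mem_singleton_iff] at ha hb
    subst ha hb
    rfl⟩

/-- The underlying set of blocks of a single-block polymer. [folklore] -/
@[simp] theorem ConnectedPolymer.single_val (x : Site d) :
    (ConnectedPolymer.single x).1 = {x} := rfl

/-- **Polymer gauge configurations**: an `N × N` complex matrix on every positively oriented bond
`(x, i)`, `x ∈ X`, based in the polymer `X` — the complexified block gauge field restricted to `X`
(Bałaban's property (i): the localized term "depends on `U_k` restricted to `X`", CMP 119 (1988)
p. 259; complex values as in his analyticity spaces (2.39)). A finite-dimensional complex
normed space (sup over bonds of Frobenius norms). [cite: Balaban1988Convergent, p. 259 (i)] -/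
abbrev PolymerGaugeConfig (N : ℕ) (X : Finset (Site d)) : Type :=
  ↥X × Fin d → Matrix (Fin N) (Fin N) ℂ

variable (ρ : G →* Matrix (Fin N) (Fin N) ℂ)

/-- Restriction of a real configuration `U : bonds of ℤ^d → G` to the polymer `X` through the
representation `ρ`: `(x, i) ↦ ρ(U(x, i))`. [folklore] -/
def polymerRestrict (X : Finset (Site d)) (U : LGConfig d G) : PolymerGaugeConfig N X :=
  fun e => ρ (U ((e.1 : Site d), e.2))

/-- The action of the gauge transformation `u : ℤ^d → G` on polymer gauge configurations,
`Z(x, i) ↦ ρ(u x) Z(x, i) ρ(u(x + eᵢ))⁻¹` (the tree's `gaugeTransformZd` through `ρ`, extended to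
complex matrices; Bałaban's (G-valued) gauge transformations of the analyticity spaces, CMP 119
(1988) p. 261). [cite: Balaban1988Convergent, p. 261 (iii)] -/
def polymerGaugeAct (X : Finset (Site d)) (u : Site d → G) (Z : PolymerGaugeConfig N X) :
    PolymerGaugeConfig N X :=
  fun e => ρ (u e.1) * Z e * ρ (u ((e.1 : Site d) + Pi.single e.2 1))⁻¹

/-- The gauge symmetries of the configurations on `X`: all `polymerGaugeAct ρ X u`,
`u : ℤ^d → G`. [cite: Balaban1988Convergent, p. 261 (iii)] -/
def polymerGaugeSymmetries (X : Finset (Site d)) :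
    Set (PolymerGaugeConfig N X → PolymerGaugeConfig N X) :=
  Set.range (polymerGaugeAct ρ X)

/-- Restriction intertwines the gauge actions: `(U^u)|_X = u • (U|_X)`. [folklore] -/
theorem polymerRestrict_gaugeTransformZd (X : Finset (Site d)) (u : Site d → G) (U : LGConfig d G) :
    polymerRestrict ρ X (gaugeTransformZd u U) = polymerGaugeAct ρ X u (polymerRestrict ρ X U) := by
  funext e
  simp [polymerRestrict, polymerGaugeAct, gaugeTransformZd, map_mul]

/-- **The small-field strip of the polymer `X`** with width `r` and threshold `ε`: the open
`r`-neighbourhood in `PolymerGaugeConfig N X` of the restrictions `ρ ∘ U|_X` of the real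
configurations `U` all of whose plaquettes based in `X` are `ε`-small (tree `smallFieldRegion`,
`N - Re tr ρ(U_p) ≤ ε`) — the one-scale rendering of Bałaban's spaces `U_j(X, α₀, α₁)` of complex
configurations `U'Ũ`, `Ũ` a real small field on `X`, `U' = exp(iξA')` small (CMP 119 (1988)
p. 261 (2.34)–(2.39)); "a complex strip around the group". [cite: Balaban1988Convergent, p. 261 (2.34)–(2.39)] -/
def smallFieldStrip (r ε : ℝ) (X : Finset (Site d)) : Set (PolymerGaugeConfig N X) :=
  ⋃ U ∈ smallFieldRegion ρ {p : ZdPlaquette d | p.1 ∈ X} ε, Metric.ball (polymerRestrict ρ X U) r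

variable {ρ} in
/-- Strips are open (unions of open balls). [folklore] -/
theorem isOpen_smallFieldStrip (r ε : ℝ) (X : Finset (Site d)) :
    IsOpen (smallFieldStrip ρ r ε X) :=
  isOpen_biUnion fun _ _ => Metric.isOpen_ball

variable {ρ} in
/-- The restriction of a real small-field configuration lies in the strip (for `r > 0`). [folklore] -/
theorem polymerRestrict_mem_smallFieldStrip {r : ℝ} (hr : 0 < r) {ε : ℝ} {X : Finset (Site d)}
    {U : LGConfig d G} (hU : U ∈ smallFieldRegion ρ {p : ZdPlaquette d | p.1 ∈ X} ε) :
    polymerRestrict ρ X U ∈ smallFieldStrip ρ r ε X :=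
  Set.mem_biUnion hU (Metric.mem_ball_self hr)

/-! ### The notion: quasi-local gauge activity norms and their Banach spaces -/

/-- **A quasi-local gauge activity norm** on the unit lattice `ℤ^d` for the gauge group `G` in
the matrix representation `ρ`: the data `(κ, r, ε)` — exponential decay rate `κ` in the number of
blocks, width `r` of the complex strip around the group, small-field threshold `ε` — of the norm
`‖K‖_{κ} = sup_X e^{κ|X|} sup_{Z ∈ strip_{r,ε}(X)} ‖K(X, Z)‖` on activities `K(X, Z)` of connected
polymers `X` and complexified block gauge fields `Z` on `X` (Bałaban, CMP 119 (1988) p. 259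
(i)–(iv) with p. 261 (2.34)–(2.42), in the sup format of Dimock, Rev. Math. Phys. 25 (2013)
§3.3). Its Banach space is `𝔫.Space F`. [cite: Balaban1988Convergent, p. 261 (2.42)] -/
structure QuasilocalGaugeActivityNorm (d : ℕ) (ρ : G →* Matrix (Fin N) (Fin N) ℂ) where
  /-- The exponential decay rate `κ` (per block). -/
  κ : ℝ
  /-- The width `r` of the complex strip around the real configurations. -/
  r : ℝ
  /-- The small-field threshold `ε` on the plaquettes based in the polymer. -/
  ε : ℝ

namespace QuasilocalGaugeActivityNorm

variable {ρ} (𝔫 : QuasilocalGaugeActivityNorm d ρ)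

/-- The underlying norm data: polymers = connected polymers of `ℤ^d`, configurations on `X` =
`PolymerGaugeConfig N X`, size = number of blocks `|X|`, domains = the small-field strips. [cite: Dimock2013, §3.3 Def. 3] -/
def toPolymerActivityNorm :
    PolymerActivityNorm (ConnectedPolymer d) (fun X => PolymerGaugeConfig N X.1) where
  κ := 𝔫.κ
  size X := X.1.card
  dom X := smallFieldStrip ρ 𝔫.r 𝔫.ε X.1
  isOpen_dom X := isOpen_smallFieldStrip 𝔫.r 𝔫.ε X.1

/-- The domains of the underlying norm data are the strips. [folklore] -/
@[simp] theorem dom_eq (X : ConnectedPolymer d) :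
    𝔫.toPolymerActivityNorm.dom X = smallFieldStrip ρ 𝔫.r 𝔫.ε X.1 := rfl

/-- The weights of the underlying norm data are `e^{κ |X|}`, `|X|` the number of blocks. [folklore] -/
theorem weight_eq (X : ConnectedPolymer d) :
    𝔫.toPolymerActivityNorm.weight X = Real.exp (𝔫.κ * X.1.card) := rfl

variable (F : Type w) [NormedAddCommGroup F] [NormedSpace ℂ F]

/-- **The Banach space `𝒦_𝔫` of gauge-invariant quasi-local activities** of norm `𝔫` with values
in `F` (`F = ℂ` for pure gauge theory; a Grassmann algebra with `h`-weighted norm for activities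
`K(X, V, ψ_B)` in block fermion fields): activities `K(X, Z)` of connected polymers `X ⊆ ℤ^d` and
complexified block gauge fields `Z` on the bonds of `X`, supported and holomorphic in the strips
`strip_{r,ε}(X)` (Bałaban (ii)), invariant there under `G`-valued gauge transformations ((iii)),
with finite norm `‖K‖ = sup_X e^{κ|X|} sup_{Z ∈ strip(X)} ‖K X Z‖` ((iv), sup form). A complete
complex normed space (`instCompleteSpaceSpace`), in which "the RG map is a contraction near
`(g*, K*)`", "`K_j → K*`", "`‖K_j‖ ≤ ε_j`" are statements. [cite: Balaban1988Convergent, p. 259 (2.27) (i)–(iv)] -/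
abbrev Space : Submodule ℂ (𝔫.toPolymerActivityNorm.space F) :=
  𝔫.toPolymerActivityNorm.quasilocal F fun X => polymerGaugeSymmetries ρ X.1

/-- `𝒦_𝔫` is a Banach space (for complete `F`). [cite: Dimock2013, §3.3] -/
instance instCompleteSpaceSpace [CompleteSpace F] : CompleteSpace (𝔫.Space F) :=
  PolymerActivityNorm.instCompleteSpaceQuasilocal _ F _

variable {F}

/-- **Membership in `𝒦_𝔫`**: gauge invariance between points of the strips, and holomorphy on
the strips. [cite: Balaban1988Convergent, p. 259 (ii) (iii)] -/
theorem mem_Space_iff {K : 𝔫.toPolymerActivityNorm.space F} :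
    K ∈ 𝔫.Space F ↔
      (∀ (X : ConnectedPolymer d) (u : Site d → G), ∀ Z ∈ smallFieldStrip ρ 𝔫.r 𝔫.ε X.1,
          polymerGaugeAct ρ X.1 u Z ∈ smallFieldStrip ρ 𝔫.r 𝔫.ε X.1 →
            K X (polymerGaugeAct ρ X.1 u Z) = K X Z) ∧
        ∀ X : ConnectedPolymer d,
          DifferentiableOn ℂ (fun Z => K X Z) (smallFieldStrip ρ 𝔫.r 𝔫.ε X.1) := by
  simp only [Space, PolymerActivityNorm.mem_quasilocal_iff, polymerGaugeSymmetries,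
    Set.forall_mem_range, dom_eq]
  exact Iff.rfl

/-- **`‖K‖_𝔫 ≤ η`** for a raw family of activities (not necessarily in the space): the
predicate in which "the perturbation `W_k` has norm `≤ η` uniformly in `k`" is stated. [cite: Balaban1988Convergent, p. 261 (2.42)] -/
abbrev NormLE (W : PolymerActivity (fun X : ConnectedPolymer d => PolymerGaugeConfig N X.1) F)
    (η : ℝ) : Prop :=
  𝔫.toPolymerActivityNorm.NormLE W η

/-- For members of `𝒦_𝔫`, `‖K‖ ≤ η ↔ ‖K‖_𝔫 ≤ η` (the norm is the printed weighted sup). [cite: Dimock2013, §3.3 Def. 3] -/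
theorem norm_le_iff (K : 𝔫.Space F) {η : ℝ} (hη : 0 ≤ η) :
    ‖K‖ ≤ η ↔ 𝔫.NormLE ((K : 𝔫.toPolymerActivityNorm.space F) : PolymerActivity _ F) η :=
  PolymerActivityNorm.norm_le_iff hη

/-- `‖K X Z‖ ≤ e^{-κ|X|} ‖K‖` for members of `𝒦_𝔫` (Bałaban's (iv)). [cite: Balaban1988Convergent, p. 261 (2.42)] -/
theorem norm_apply_le (K : 𝔫.Space F) (X : ConnectedPolymer d) (Z : PolymerGaugeConfig N X.1) :
    ‖(K : 𝔫.toPolymerActivityNorm.space F) X Z‖ ≤ Real.exp (-(𝔫.κ * X.1.card)) * ‖K‖ := by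
  rw [Real.exp_neg]
  exact PolymerActivityNorm.norm_apply_le (K : 𝔫.toPolymerActivityNorm.space F) X Z

/-- **Evaluation on a real block gauge field**: `K(X, U) := K X (ρ ∘ U|_X)` for
`U : bonds of ℤ^d → G` — the quantity summed in "effective action `= S_Wilson(g_j) + Σ_X K_j(X, U)`". [cite: Balaban1988Convergent, p. 259 (2.27)] -/
def onField (K : 𝔫.Space F) (X : ConnectedPolymer d) (U : LGConfig d G) : F :=
  (K : 𝔫.toPolymerActivityNorm.space F) X (polymerRestrict ρ X.1 U)

/-- **Gauge invariance on real small fields**: for `r > 0` and `U` in the small-field region of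
`X`, `K(X, U^u) = K(X, U)` for every gauge transformation `u` (the real trace of Bałaban's (iii);
the small-field region is gauge invariant, tree `gaugeTransformZd_mem_smallFieldRegion_iff`). [cite: Balaban1988Convergent, p. 259 (iii)] -/
theorem onField_gaugeTransformZd (K : 𝔫.Space F) (hr : 0 < 𝔫.r) (X : ConnectedPolymer d)
    (u : Site d → G) {U : LGConfig d G}
    (hU : U ∈ smallFieldRegion ρ {p : ZdPlaquette d | p.1 ∈ X.1} 𝔫.ε) :
    𝔫.onField K X (gaugeTransformZd u U) = 𝔫.onField K X U := by
  have hmem := (𝔫.mem_Space_iff.1 K.2).1 X u (polymerRestrict ρ X.1 U)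
    (polymerRestrict_mem_smallFieldStrip hr hU)
  rw [onField, onField, polymerRestrict_gaugeTransformZd]
  refine hmem ?_
  rw [← polymerRestrict_gaugeTransformZd]
  exact polymerRestrict_mem_smallFieldStrip hr
    ((gaugeTransformZd_mem_smallFieldRegion_iff ρ _ _ u U).2 hU)

/-- **Non-vacuity**: for `r > 0`, `ε ≥ 0` and non-trivial `F`, `𝒦_𝔫` has non-zero elements —
e.g. the activity equal to a constant `c ≠ 0` on the strip of one single-block polymer and zero
elsewhere (the strip contains the trivial configuration). [folklore] -/
theorem exists_ne_zero [Nontrivial F] (hr : 0 < 𝔫.r) (hε : 0 ≤ 𝔫.ε) (x : Site d) :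
    ∃ K : 𝔫.Space F, K ≠ 0 := by
  classical
  obtain ⟨c, hc⟩ := exists_ne (0 : F)
  set X₀ : ConnectedPolymer d := ConnectedPolymer.single x
  -- the raw activity: constant `c` on the strip of `X₀`, zero elsewhere
  let K₀ : PolymerActivity (fun X : ConnectedPolymer d => PolymerGaugeConfig N X.1) F :=
    fun X Z => if X = X₀ then (smallFieldStrip ρ 𝔫.r 𝔫.ε X.1).indicator (fun _ => c) Z else 0
  have hK₀ : K₀ ∈ 𝔫.toPolymerActivityNorm.space F := by
    refine ⟨fun X Z hZ => ?_, max (𝔫.toPolymerActivityNorm.weight X₀ * ‖c‖) 0, fun X Z _ => ?_⟩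
    · by_cases hX : X = X₀
      · simp only [K₀, if_pos hX]
        exact Set.indicator_of_notMem hZ _
      · simp [K₀, hX]
    · by_cases hX : X = X₀
      · subst hX
        simp only [K₀, if_true]
        refine le_trans ?_ (le_max_left _ _)
        refine mul_le_mul_of_nonneg_left ?_ (PolymerActivityNorm.weight_pos _ _).le
        exact norm_indicator_le_norm_self (fun _ => c) Z
      · simp [K₀, hX]
  have hK₁ : (⟨K₀, hK₀⟩ : 𝔫.toPolymerActivityNorm.space F) ∈ 𝔫.Space F := by
    rw [mem_Space_iff]
    refine ⟨fun X u Z hZ huZ => ?_, fun X => ?_⟩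
    · change K₀ X _ = K₀ X Z
      by_cases hX : X = X₀
      · simp only [K₀, if_pos hX, Set.indicator_of_mem hZ, Set.indicator_of_mem huZ]
      · simp [K₀, hX]
    · change DifferentiableOn ℂ (fun Z => K₀ X Z) _
      by_cases hX : X = X₀
      · simp only [K₀, if_pos hX]
        exact (differentiableOn_const c).congr fun Z hZ => Set.indicator_of_mem hZ _
      · simp only [K₀, if_neg hX]
        exact differentiableOn_const 0
  refine ⟨⟨⟨K₀, hK₀⟩, hK₁⟩, fun h => hc ?_⟩
  have h1 : K₀ X₀ (polymerRestrict ρ X₀.1 1) = 0 := by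
    have := congr_arg (fun K : 𝔫.Space F => (K : 𝔫.toPolymerActivityNorm.space F) X₀
      (polymerRestrict ρ X₀.1 1)) h
    simpa using this
  have hmem : polymerRestrict ρ X₀.1 (1 : LGConfig d G) ∈ smallFieldStrip ρ 𝔫.r 𝔫.ε X₀.1 :=
    polymerRestrict_mem_smallFieldStrip hr (one_mem_smallFieldRegion ρ _ hε)
  simpa [K₀, Set.indicator_of_mem hmem] using h1

end QuasilocalGaugeActivityNorm

end Gauge

end Literature.MathematicalPhysics.QuantumLattice
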